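import Mathlib
import Literature.Analysis.PDE.DoublingLemma
import HarnessLib

/-!
# `DSolutionBubble.TypeIISlowDoublingEternal` (item stmt-NavierStokesRegularity-4064) — tools:
# slow-doubling cells of a non-Type-I blow-up (Poláčik–Quittner–Souplet point picking)

Helper file for the support item `Theses.DSolutionBubble.TypeIISlowDoublingEternal`. Pure
bookkeeping about a field `w : ℝ → ℝ³ → ℝ³` on `[0, T₁) × ℝ³` (no equation is used): if `w` is
bounded on every `[0, T'] × ℝ³`, `T' < T₁`, `w(0, ·) ≢ 0`, and the Type-I rate FAILS in the
quantitative form "for every `C` and every `τ₁ < T₁` some `τ ∈ (τ₁, T₁)`, `x` have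
`‖w(τ, x)‖² (T₁ − τ) > C`", then for every `k : ℕ` there is a SLOW-DOUBLING CELL: a centre
`(t', x)` with `N = ‖w(t', x)‖ > 0` and a forward length `ℓ > 0`, `t' + ℓ < T₁`, such that

* (past) `‖w(σ, y)‖ ≤ (1 + 1/(k+3)) N` for `0 ≤ σ ≤ t'`;
* (window) `‖w(σ, y)‖ ≤ 2N` for `0 ≤ σ ≤ t' + ℓ`;
* (lengths) `ℓ N² ≥ k` and `t' N² ≥ k`.

PROOF (`exists_slowDoubling_cells`). Let `M(τ) = sup_{[0,τ] × ℝ³} ‖w‖` (finite, positive,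
monotone, bounded on compact subsets of `[0, T₁)`). Apply the doubling lemma of
Poláčik–Quittner–Souplet (`Literature.Analysis.PDE.DoublingLemma`, PROVED in the tree) on
`D = [0, T₁) ⊂ S = [0, T₁]`, `Γ = {T₁}`, to `M²` with parameter `k' = 2(k+1)`, starting from a
point `y` where `M(y)²(T₁ − y)` is large (failure of the Type-I rate): it returns `τ` with
`M(z)² ≤ 2 M(τ)²` for `|z − τ| ≤ k'/M(τ)²` and `2k'/M(τ)² < T₁ − τ`. A point `(t', x)`, `t' ≤ τ`,
almost realising `M(τ)` is the centre; `ℓ = τ + k'/M(τ)² − t'`. Largeness of `M(y)` forces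
`t' > T₁/2`, whence `t' N² ≥ k`.

HONEST FRAMING: point-picking bookkeeping for HYPOTHETICAL blow-up profiles (other route, not a
pub-ns-dss cell file); nothing here bears on the regularity problem itself.

References: P. Poláčik, P. Quittner, P. Souplet, Indiana Univ. Math. J. 56 (2007), Lemma 5.1;
Koch–Nadirashvili–Seregin–Šverák 2009 §6. [PolacikQuittnerSouplet2007]
[KochNadirashviliSereginSverak2009]
-/

noncomputable section

set_option linter.dupNamespace false

namespace Summit.NavierStokesRegularity.NavierStokesRegularity.Theorems

open MeasureTheory Set Function Filter Topology TopologicalSpace Metric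
open scoped NNReal ENNReal

namespace TypeIISlowDoublingEternal

/-- **Slow-doubling cells** (module docstring): for `w` bounded on every `[0, T'] × ℝ³`
(`T' < T₁`), `w(0, ·) ≢ 0`, and the quantitative failure of the Type-I rate, every `k : ℕ` admits
a centre `(t', x)`, `N = ‖w(t', x)‖ > 0`, and a length `ℓ > 0` with `t' + ℓ < T₁`,
`‖w‖ ≤ (1 + 1/(k+3)) N` on `[0, t'] × ℝ³`, `‖w‖ ≤ 2N` on `[0, t' + ℓ] × ℝ³`, `ℓ N² ≥ k`, `t' N² ≥ k`
(Poláčik–Quittner–Souplet doubling for the running supremum).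
[cite: PolacikQuittnerSouplet2007, Lemma 5.1 (p. 14)] -/
theorem exists_slowDoubling_cells {T₁ : ℝ} (hT₁ : 0 < T₁)
    {w : ℝ → EuclideanSpace ℝ (Fin 3) → EuclideanSpace ℝ (Fin 3)}
    (hbdd : ∀ T' < T₁, ∃ Mb : ℝ, ∀ σ ∈ Icc (0 : ℝ) T', ∀ y, ‖w σ y‖ ≤ Mb)
    (hnz : ∃ y₀, w 0 y₀ ≠ 0)
    (hnotI : ∀ C : ℝ, ∀ τ₁ < T₁, ∃ τ ∈ Ioo τ₁ T₁, 0 ≤ τ ∧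
      ∃ x : EuclideanSpace ℝ (Fin 3), C < ‖w τ x‖ ^ 2 * (T₁ - τ))
    (k : ℕ) :
    ∃ (t' ℓ : ℝ) (x : EuclideanSpace ℝ (Fin 3)), 0 ≤ t' ∧ 0 < ℓ ∧ t' + ℓ < T₁ ∧
      0 < ‖w t' x‖ ∧
      (∀ σ ∈ Icc (0 : ℝ) t', ∀ y, ‖w σ y‖ ≤ (1 + 1 / ((k : ℝ) + 3)) * ‖w t' x‖) ∧
      (∀ σ ∈ Icc (0 : ℝ) (t' + ℓ), ∀ y, ‖w σ y‖ ≤ 2 * ‖w t' x‖) ∧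
      (k : ℝ) ≤ ℓ * ‖w t' x‖ ^ 2 ∧ (k : ℝ) ≤ t' * ‖w t' x‖ ^ 2 := by
  obtain ⟨y₀, hy₀⟩ := hnz
  -- ### the running supremum `M τ = sup_{[0, τ] × ℝ³} ‖w‖`
  obtain ⟨M, hM⟩ : ∃ M : ℝ → ℝ, ∀ τ, M τ =
      sSup ((fun p : ℝ × EuclideanSpace ℝ (Fin 3) => ‖w p.1 p.2‖) '' (Icc (0 : ℝ) τ ×ˢ univ)) :=
    ⟨_, fun _ => rfl⟩
  have hne : ∀ τ : ℝ, 0 ≤ τ →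
      ((fun p : ℝ × EuclideanSpace ℝ (Fin 3) => ‖w p.1 p.2‖) '' (Icc (0 : ℝ) τ ×ˢ univ)).Nonempty :=
    fun τ hτ => ⟨_, ⟨((0 : ℝ), y₀), ⟨⟨le_rfl, hτ⟩, mem_univ _⟩, rfl⟩⟩
  have hba : ∀ τ : ℝ, τ < T₁ →
      BddAbove ((fun p : ℝ × EuclideanSpace ℝ (Fin 3) => ‖w p.1 p.2‖) '' (Icc (0 : ℝ) τ ×ˢ univ)) := by
    intro τ hτ
    obtain ⟨Mb, hMb⟩ := hbdd τ hτ
    refine ⟨Mb, ?_⟩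
    rintro _ ⟨p, hp, rfl⟩
    exact hMb p.1 hp.1 p.2
  -- (M1) the bound
  have hM1 : ∀ τ : ℝ, τ < T₁ → ∀ σ ∈ Icc (0 : ℝ) τ, ∀ y, ‖w σ y‖ ≤ M τ := by
    intro τ hτ σ hσ y
    rw [hM]
    exact le_csSup (hba τ hτ) ⟨(σ, y), ⟨hσ, mem_univ _⟩, rfl⟩
  -- (M2) monotonicity
  have hM2 : ∀ σ τ : ℝ, 0 ≤ σ → σ ≤ τ → τ < T₁ → M σ ≤ M τ := by
    intro σ τ hσ hστ hτ
    rw [hM, hM]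
    exact csSup_le_csSup (hba τ hτ) (hne σ hσ)
      (image_mono (prod_mono (Icc_subset_Icc_right hστ) Subset.rfl))
  -- (M3) positivity
  have hM3 : ∀ τ : ℝ, 0 ≤ τ → τ < T₁ → 0 < M τ := fun τ hτ hτT =>
    (norm_pos_iff.2 hy₀).trans_le (hM1 τ hτT 0 ⟨le_rfl, hτ⟩ y₀)
  -- (M4) near-attainment
  have hM4 : ∀ τ : ℝ, 0 ≤ τ → τ < T₁ → ∀ ε > (0 : ℝ),
      ∃ σ ∈ Icc (0 : ℝ) τ, ∃ y, M τ - ε < ‖w σ y‖ := by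
    intro τ hτ hτT ε hε
    have h : M τ - ε < sSup ((fun p : ℝ × EuclideanSpace ℝ (Fin 3) => ‖w p.1 p.2‖) ''
        (Icc (0 : ℝ) τ ×ˢ univ)) := by rw [← hM]; linarith
    obtain ⟨_, ⟨p, hp, rfl⟩, hlt⟩ := exists_lt_of_lt_csSup (hne τ hτ) h
    exact ⟨p.1, hp.1, p.2, hlt⟩
  -- (M5) boundedness of `M²` on compact subsets of `[0, T₁)`
  have hM5 : ∀ K : Set ℝ, K ⊆ Ico (0 : ℝ) T₁ → IsCompact K → ∃ C : ℝ, ∀ z ∈ K, M z ^ 2 ≤ C := by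
    intro K hK hKc
    rcases K.eq_empty_or_nonempty with h | h
    · exact ⟨0, fun z hz => by simp [h] at hz⟩
    · have hsup : sSup K ∈ K := hKc.sSup_mem h
      refine ⟨M (sSup K) ^ 2, fun z hz => ?_⟩
      have hz0 : 0 ≤ z := (hK hz).1
      have hzle : z ≤ sSup K := le_csSup hKc.bddAbove hz
      have h1 : M z ≤ M (sSup K) := hM2 z _ hz0 hzle (hK hsup).2
      have h0 : 0 ≤ M z := (hM3 z hz0 (hK hz).2).le
      exact pow_le_pow_left₀ h0 h1 2
  -- ### parameters (kept opaque)
  have hk3 : (0 : ℝ) < (k : ℝ) + 3 := by positivity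
  obtain ⟨δ, hδ⟩ : ∃ δ : ℝ, δ = 1 / ((k : ℝ) + 3) := ⟨_, rfl⟩
  have hδpos : 0 < δ := by rw [hδ]; positivity
  have hδle : δ ≤ 1 / 3 := by
    rw [hδ]
    exact div_le_div_of_nonneg_left zero_le_one (by norm_num)
      (by linarith [k.cast_nonneg (α := ℝ)])
  obtain ⟨k', hk'⟩ : ∃ k' : ℝ, k' = 2 * ((k : ℝ) + 1) := ⟨_, rfl⟩
  have hk'pos : 0 < k' := by rw [hk']; positivity
  have hk'k : (k : ℝ) + 1 ≤ k' := by rw [hk']; linarith [k.cast_nonneg (α := ℝ)]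
  have hhalf : T₁ / 2 ∈ Ico (0 : ℝ) T₁ := ⟨by linarith, by linarith⟩
  obtain ⟨Mh, hMh⟩ : ∃ Mh : ℝ, Mh = M (T₁ / 2) := ⟨_, rfl⟩
  have hMh0 : 0 < Mh := by rw [hMh]; exact hM3 _ hhalf.1 hhalf.2
  obtain ⟨C, hCdef⟩ : ∃ C : ℝ, C = T₁ * (2 * (Mh + 1)) ^ 2 + 4 * k' := ⟨_, rfl⟩
  have hC4 : 4 * k' ≤ C := by
    rw [hCdef]; nlinarith [sq_nonneg (2 * (Mh + 1))]
  have hCM : T₁ * (2 * (Mh + 1)) ^ 2 ≤ C := by rw [hCdef]; linarith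
  -- ### the starting point `y`: failure of the Type-I rate
  obtain ⟨y, hy, hy0, x₁, hx₁⟩ := hnotI C (T₁ / 2) (by linarith)
  have hyD : y ∈ Ico (0 : ℝ) T₁ := ⟨hy0, hy.2⟩
  have hTy : 0 < T₁ - y := sub_pos.2 hy.2
  have hMy : C < M y ^ 2 * (T₁ - y) := by
    have h1 : ‖w y x₁‖ ≤ M y := hM1 y hy.2 y ⟨hy0, le_rfl⟩ x₁
    have h2 : ‖w y x₁‖ ^ 2 ≤ M y ^ 2 := pow_le_pow_left₀ (norm_nonneg _) h1 2
    exact hx₁.trans_le (mul_le_mul_of_nonneg_right h2 hTy.le)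
  have hMy' : C / T₁ < M y ^ 2 := by
    rw [div_lt_iff₀ hT₁]
    exact hMy.trans_le (mul_le_mul_of_nonneg_left (by linarith) (sq_nonneg _))
  -- ### the doubling lemma for `M²` on `[0, T₁) ⊂ [0, T₁]`
  have hΓ : Icc (0 : ℝ) T₁ \ Ico 0 T₁ = {T₁} := Icc_sdiff_Ico_same hT₁.le
  have hpos2 : ∀ z ∈ Ico (0 : ℝ) T₁, 0 < M z ^ 2 := fun z hz => pow_pos (hM3 z hz.1 hz.2) 2
  have hy51 : 2 * k' / M y ^ 2 < infDist y (Icc (0 : ℝ) T₁ \ Ico 0 T₁) := by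
    rw [hΓ, infDist_singleton, Real.dist_eq, abs_of_neg (by linarith), neg_sub,
      div_lt_iff₀ (hpos2 y hyD)]
    nlinarith [hC4]
  obtain ⟨τ, hτD, hτ51, hMyτ, hdoub⟩ :=
    Literature.Analysis.PDE.polacikQuittnerSouplet_doubling_of_infDist (X := ℝ)
      (D := Ico (0 : ℝ) T₁) (S := Icc (0 : ℝ) T₁) Ico_subset_Icc_self isClosed_Icc
      (M := fun z => M z ^ 2) hpos2 hM5 hk'pos hyD (by rw [hΓ]; exact singleton_nonempty _) hy51
  have hMτ0 : 0 < M τ := hM3 τ hτD.1 hτD.2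
  have hMτ2 : 0 < M τ ^ 2 := pow_pos hMτ0 2
  rw [hΓ, infDist_singleton, Real.dist_eq, abs_of_neg (by linarith [hτD.2]), neg_sub] at hτ51
  -- the forward length `ℓ₀ = k'/M(τ)²`
  obtain ⟨ℓ₀, hℓ₀⟩ : ∃ ℓ₀ : ℝ, ℓ₀ = k' / M τ ^ 2 := ⟨_, rfl⟩
  have hℓ₀pos : 0 < ℓ₀ := by rw [hℓ₀]; exact div_pos hk'pos hMτ2
  have hℓ₀M : ℓ₀ * M τ ^ 2 = k' := by rw [hℓ₀]; field_simp
  have hℓ₀T : τ + ℓ₀ < T₁ := by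
    have : 2 * k' / M τ ^ 2 = 2 * ℓ₀ := by rw [hℓ₀]; ring
    linarith
  -- `M` after `τ`: at most `√2 · M τ` on `[τ, τ + ℓ₀]`
  have hforward : ∀ σ ∈ Icc τ (τ + ℓ₀), M σ ^ 2 ≤ 2 * M τ ^ 2 := by
    intro σ hσ
    refine hdoub σ ⟨hτD.1.trans hσ.1, hσ.2.trans_lt hℓ₀T⟩ ?_
    rw [Real.dist_eq, abs_of_nonneg (by linarith [hσ.1])]
    show σ - τ ≤ k' / M τ ^ 2
    rw [← hℓ₀]
    linarith [hσ.2]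
  -- ### the centre: a point almost realising `M τ`
  obtain ⟨t', ht', x, hx⟩ := hM4 τ hτD.1 hτD.2 (M τ * (δ / (1 + δ))) (by positivity)
  obtain ⟨N, hNdef⟩ : ∃ N : ℝ, N = ‖w t' x‖ := ⟨_, rfl⟩
  rw [← hNdef] at hx
  have hNM : M τ < (1 + δ) * N := by
    have h1 : M τ - M τ * (δ / (1 + δ)) = M τ / (1 + δ) := by field_simp; ring
    rw [h1, div_lt_iff₀ (by positivity)] at hx
    linarith
  have hNle : N ≤ M τ := by rw [hNdef]; exact hM1 τ hτD.2 t' ht' x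
  have hN0 : 0 ≤ N := by rw [hNdef]; exact norm_nonneg _
  have hNpos : 0 < N := by
    rcases hN0.eq_or_lt with h | h
    · rw [← h, mul_zero] at hNM; linarith
    · exact h
  have hN43 : (1 + δ) * N ≤ 4 / 3 * N := mul_le_mul_of_nonneg_right (by linarith) hN0
  -- `M y ≤ M τ`, so `N` is large: `N > Mh + 1`, hence `t' > T₁/2`
  have hMyτ2 : M y ^ 2 ≤ M τ ^ 2 := hMyτ
  have hMyτ' : M y ≤ M τ := by
    by_contra hlt
    push Not at hlt
    have : M τ ^ 2 < M y ^ 2 := pow_lt_pow_left₀ hlt hMτ0.le two_ne_zero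
    linarith
  have hNlarge : Mh + 1 < N := by
    have h1 : (2 * (Mh + 1)) ^ 2 ≤ C / T₁ := by
      rw [le_div_iff₀ hT₁]; linarith [hCM]
    have h2 : (2 * (Mh + 1)) ^ 2 < M τ ^ 2 := (h1.trans_lt hMy').trans_le hMyτ2
    have h3 : 2 * (Mh + 1) < M τ := by
      by_contra hle
      push Not at hle
      have : M τ ^ 2 ≤ (2 * (Mh + 1)) ^ 2 := pow_le_pow_left₀ hMτ0.le hle 2
      linarith
    linarith [hNM, hN43]
  have ht'half : T₁ / 2 < t' := by
    by_contra hle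
    push Not at hle
    have h1 : N ≤ Mh := by rw [hNdef, hMh]; exact hM1 _ hhalf.2 t' ⟨ht'.1, hle⟩ x
    linarith
  -- ### the cell
  refine ⟨t', τ + ℓ₀ - t', x, ht'.1, by linarith [ht'.2], by linarith, ?_, ?_, ?_, ?_, ?_⟩
  · rw [← hNdef]; exact hNpos
  · -- past bound
    intro σ hσ y'
    have h1 : ‖w σ y'‖ ≤ M τ := hM1 τ hτD.2 σ ⟨hσ.1, hσ.2.trans ht'.2⟩ y'
    rw [← hδ, ← hNdef]
    linarith
  · -- window bound
    intro σ hσ y'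
    rw [← hNdef]
    have hσ' : σ ≤ τ + ℓ₀ := by linarith [hσ.2]
    rcases le_or_gt σ τ with h | h
    · have h1 : ‖w σ y'‖ ≤ M τ := hM1 τ hτD.2 σ ⟨hσ.1, h⟩ y'
      linarith [hNM, hN43]
    · have hσT : σ < T₁ := hσ'.trans_lt hℓ₀T
      have h1 : ‖w σ y'‖ ≤ M σ := hM1 σ hσT σ ⟨hσ.1, le_rfl⟩ y'
      have h2 : M σ ^ 2 ≤ 2 * M τ ^ 2 := hforward σ ⟨h.le, hσ'⟩
      have hMσ0 : 0 < M σ := hM3 σ hσ.1 hσT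
      -- `M σ ≤ √2 M τ < √2 (1 + δ) N ≤ 2 N` since `(1 + δ)² · 2 ≤ 4` for `δ ≤ 1/3`
      have h3 : M τ ^ 2 < ((1 + δ) * N) ^ 2 := pow_lt_pow_left₀ hNM hMτ0.le two_ne_zero
      have h4 : ((1 + δ) * N) ^ 2 ≤ 16 / 9 * N ^ 2 :=
        calc ((1 + δ) * N) ^ 2 ≤ (4 / 3 * N) ^ 2 := pow_le_pow_left₀ (by positivity) hN43 2
          _ = 16 / 9 * N ^ 2 := by ring
      have h5 : M σ ^ 2 < 4 * N ^ 2 := by linarith [h2, h3, h4]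
      have h6 : M σ < 2 * N := by
        by_contra hle
        push Not at hle
        have h7 : (2 * N) ^ 2 ≤ M σ ^ 2 := pow_le_pow_left₀ (by positivity) hle 2
        have h8 : (2 * N) ^ 2 = 4 * N ^ 2 := by ring
        rw [h8] at h7
        linarith
      linarith
  · -- forward rescaled length: `ℓ₀ N² ≥ (9/16) ℓ₀ (4N/3)² ≥ (9/16) ℓ₀ M τ² = (9/16) k' ≥ k`
    rw [← hNdef]
    have h1 : ℓ₀ * N ^ 2 ≤ (τ + ℓ₀ - t') * N ^ 2 :=
      mul_le_mul_of_nonneg_right (by linarith [ht'.2]) (sq_nonneg _)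
    refine le_trans ?_ h1
    have h2 : M τ ^ 2 < ((1 + δ) * N) ^ 2 := pow_lt_pow_left₀ hNM hMτ0.le two_ne_zero
    have h3 : ((1 + δ) * N) ^ 2 ≤ 16 / 9 * N ^ 2 :=
      calc ((1 + δ) * N) ^ 2 ≤ (4 / 3 * N) ^ 2 := pow_le_pow_left₀ (by positivity) hN43 2
        _ = 16 / 9 * N ^ 2 := by ring
    have h4 : M τ ^ 2 ≤ 16 / 9 * N ^ 2 := by linarith [h2, h3]
    have h5 : ℓ₀ * M τ ^ 2 ≤ ℓ₀ * (16 / 9 * N ^ 2) := mul_le_mul_of_nonneg_left h4 hℓ₀pos.le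
    rw [hℓ₀M, hk'] at h5
    have h6 : ℓ₀ * (16 / 9 * N ^ 2) = 16 / 9 * (ℓ₀ * N ^ 2) := by ring
    rw [h6] at h5
    linarith [h5, k.cast_nonneg (α := ℝ)]
  · -- backward rescaled length: `t' N² ≥ (T₁/2)(9/16) M y² ≥ (9/32) C ≥ k`
    rw [← hNdef]
    have h1 : T₁ / 2 * N ^ 2 ≤ t' * N ^ 2 :=
      mul_le_mul_of_nonneg_right ht'half.le (sq_nonneg _)
    refine le_trans ?_ h1
    have hMyN : M y < (1 + δ) * N := hMyτ'.trans_lt hNM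
    have h2 : M y ^ 2 < ((1 + δ) * N) ^ 2 :=
      pow_lt_pow_left₀ hMyN (hM3 y hyD.1 hyD.2).le two_ne_zero
    have h3 : ((1 + δ) * N) ^ 2 ≤ 16 / 9 * N ^ 2 :=
      calc ((1 + δ) * N) ^ 2 ≤ (4 / 3 * N) ^ 2 := pow_le_pow_left₀ (by positivity) hN43 2
        _ = 16 / 9 * N ^ 2 := by ring
    have h4 : M y ^ 2 ≤ 16 / 9 * N ^ 2 := by linarith [h2, h3]
    have h5 : C < T₁ * M y ^ 2 := by
      have := hMy'
      rwa [div_lt_iff₀' hT₁] at this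
    have h6 : T₁ * M y ^ 2 ≤ T₁ * (16 / 9 * N ^ 2) := mul_le_mul_of_nonneg_left h4 hT₁.le
    have h7 : T₁ * (16 / 9 * N ^ 2) = 32 / 9 * (T₁ / 2 * N ^ 2) := by ring
    rw [h7] at h6
    rw [hk'] at hC4
    linarith [h5, h6, hC4, k.cast_nonneg (α := ℝ)]

end TypeIISlowDoublingEternal

end Summit.NavierStokesRegularity.NavierStokesRegularity.Theorems

end
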